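import Mathlib.Geometry.Manifold.Diffeomorph
import Mathlib.Geometry.Manifold.MFDeriv.Basic
import Mathlib.Geometry.Manifold.MFDeriv.SpecificFunctions
import HarnessLib

/-!
# Changing the model vector space of a manifold by a continuous linear equivalence:
# differentials

A `C^∞` manifold `M` modelled on `I : ModelWithCorners ℝ E H` is also a `C^∞` manifold modelled
on `I.transContinuousLinearEquiv e : ModelWithCorners ℝ E' H` for any continuous linear
equivalence `e : E ≃L[ℝ] E'` (same charts, model map `e ∘ I`; Mathlib,
`ModelWithCorners.transContinuousLinearEquiv`, with the identity diffeomorphism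
`ContinuousLinearEquiv.toTransContinuousLinearEquiv` and the `ContMDiff` transfer lemmas
`contMDiff_transContinuousLinearEquiv_left/right`). In particular every manifold modelled on a
finite-dimensional `E` is, without changing its points, charts or smooth functions, a manifold
modelled on `EuclideanSpace ℝ (Fin (dim E))` — the setting of the tree's chart formulas for the
Riemannian measure and of Green's identity. This file PROVES how DIFFERENTIALS transform
(Mathlib has the `ContMDiff` statements only), the input of the transport of metrics,
connections, distances and volumes along the identity (`ModelTransportMetric.lean`):

* `writtenInExtChartAt_transCLE_right/left` — the written-in-charts expressions acquire the
  factor `e` on the left, resp. `e⁻¹` on the right (definitional);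
* `mdifferentiableAt_transCLE_right/left` — differentiability is unchanged;
* `mfderiv_transCLE_right` — for `f : N → M`, changing the model of the TARGET:
  `mfderiv J (I.trans e) f x = e ∘ mfderiv J I f x`;
* `mfderiv_transCLE_left` — for `f : M → N`, changing the model of the SOURCE:
  `mfderiv (I.trans e) J f x = mfderiv I J f x ∘ e⁻¹`;
* `mfderiv_id_transCLE`, `mfderiv_id_transCLE'` — the identity `(M, I.trans e) → (M, I)` has
  differential `e⁻¹ : E' → E`, and `(M, I) → (M, I.trans e)` has differential `e`; both are
  injective; `contMDiff_id_transCLE`, `contMDiff_id_transCLE'` — both are `C^n`;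
(Boundarylessness is preserved too: `Literature.Topology.FourManifolds.boundaryless_transContinuousLinearEquiv`,
`CylinderCobordism.lean`, not imported here; consumers re-derive the one-line instance.)

Everything is proved; no definitions, no named facts. (Lee, *Introduction to Smooth Manifolds*,
2nd ed., Ch. 1, "smooth structures determined by an atlas are unchanged under composing the
charts with a fixed diffeomorphism of the model"; here the linear case, as in Mathlib.)

## References

* J. M. Lee, *Introduction to Smooth Manifolds*, 2nd ed., GTM 218, Springer 2013, Ch. 1
  (Prop. 1.17 ff.) and Ch. 3 (Prop. 3.6, differentials in charts). [Lee2013]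
-/

noncomputable section

open Set Function Manifold
open scoped Manifold ContDiff Topology

namespace Literature.Geometry.Riemannian

variable {E : Type*} [NormedAddCommGroup E] [NormedSpace ℝ E]
  {E' : Type*} [NormedAddCommGroup E'] [NormedSpace ℝ E']
  {H : Type*} [TopologicalSpace H] (I : ModelWithCorners ℝ E H) (e : E ≃L[ℝ] E')
  {M : Type*} [TopologicalSpace M] [ChartedSpace H M]
  {F : Type*} [NormedAddCommGroup F] [NormedSpace ℝ F]
  {G : Type*} [TopologicalSpace G] {J : ModelWithCorners ℝ F G}
  {N : Type*} [TopologicalSpace N] [ChartedSpace G N]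

/-! ### Changing the model of the target -/

omit [ChartedSpace H M] in
/-- The written-in-charts expression of `f : N → M` for the target model `I.trans e` is `e`
composed with the one for `I` (definitional: `extChartAt (I.trans e) y = e ∘ extChartAt I y`).
[folklore] -/
theorem writtenInExtChartAt_transCLE_right [ChartedSpace H M] (f : N → M) (x : N) :
    writtenInExtChartAt J (I.transContinuousLinearEquiv e) x f = e ∘ writtenInExtChartAt J I x f :=
  rfl

/-- Differentiability of `f : N → M` does not depend on the linear change of the target model.
[folklore] -/
theorem mdifferentiableAt_transCLE_right {f : N → M} {x : N} :
    MDifferentiableAt J (I.transContinuousLinearEquiv e) f x ↔ MDifferentiableAt J I f x := by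
  rw [mdifferentiableAt_iff, mdifferentiableAt_iff, writtenInExtChartAt_transCLE_right,
    e.comp_differentiableWithinAt_iff]

/-- **The differential for a changed target model**: for `f : N → M` and the model `I.trans e` on
`M`, `d f_x = e ∘ d f_x` (the tangent spaces of `(M, I.trans e)` being copies of `E'`): the
written-in-charts expression is `e ∘ (φ ∘ f ∘ φ_N⁻¹)` and `D(e ∘ F) = e ∘ DF`.
[cite: Lee2013, Ch. 3, Prop. 3.6] -/
theorem mfderiv_transCLE_right (f : N → M) (x : N) :
    mfderiv J (I.transContinuousLinearEquiv e) f x = (e : E →L[ℝ] E').comp (mfderiv J I f x) := by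
  by_cases hf : MDifferentiableAt J I f x
  · have hf' : MDifferentiableAt J (I.transContinuousLinearEquiv e) f x :=
      (mdifferentiableAt_transCLE_right I e).2 hf
    rw [hf'.mfderiv, hf.mfderiv, writtenInExtChartAt_transCLE_right]
    exact e.comp_fderivWithin (J.uniqueDiffOn _ (mem_range_self _))
  · have hf' : ¬ MDifferentiableAt J (I.transContinuousLinearEquiv e) f x := fun h ↦
      hf ((mdifferentiableAt_transCLE_right I e).1 h)
    rw [mfderiv_zero_of_not_mdifferentiableAt hf', mfderiv_zero_of_not_mdifferentiableAt hf]
    ext v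
    exact (e.map_zero).symm

/-- The differential applied to a vector: `d f_x(v)` for the model `I.trans e` is `e (d f_x(v))`.
[cite: Lee2013, Ch. 3, Prop. 3.6] -/
theorem mfderiv_transCLE_right_apply (f : N → M) (x : N) (v : TangentSpace J x) :
    mfderiv J (I.transContinuousLinearEquiv e) f x v = e (mfderiv J I f x v) := by
  rw [mfderiv_transCLE_right]; rfl

/-! ### Changing the model of the source -/

/-- The written-in-charts expression of `f : M → N` for the source model `I.trans e` is the one
for `I` precomposed with `e⁻¹` (definitional). [folklore] -/
theorem writtenInExtChartAt_transCLE_left (f : M → N) (x : M) :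
    writtenInExtChartAt (I.transContinuousLinearEquiv e) J x f =
      writtenInExtChartAt I J x f ∘ e.symm :=
  rfl

/-- The base point of the extended chart for `I.trans e` is `e` of the one for `I`. [folklore] -/
theorem extChartAt_transCLE_apply (x y : M) :
    extChartAt (I.transContinuousLinearEquiv e) x y = e (extChartAt I x y) := rfl

/-- The range of `I.trans e` is the preimage of the range of `I` under `e⁻¹`. [folklore] -/
theorem range_transCLE_eq_preimage :
    range (I.transContinuousLinearEquiv e) = e.symm ⁻¹' range I := by
  rw [ModelWithCorners.transContinuousLinearEquiv_range, e.image_eq_preimage_symm]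

/-- Differentiability of `f : M → N` does not depend on the linear change of the source model.
[folklore] -/
theorem mdifferentiableAt_transCLE_left {f : M → N} {x : M} :
    MDifferentiableAt (I.transContinuousLinearEquiv e) J f x ↔ MDifferentiableAt I J f x := by
  rw [mdifferentiableAt_iff, mdifferentiableAt_iff, writtenInExtChartAt_transCLE_left,
    range_transCLE_eq_preimage, extChartAt_transCLE_apply,
    e.symm.comp_right_differentiableWithinAt_iff, e.symm_apply_apply]

/-- **The differential for a changed source model**: for `f : M → N` and the model `I.trans e` on
`M`, `d f_x = d f_x ∘ e⁻¹` (tangent spaces of `(M, I.trans e)` being copies of `E'`): the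
written-in-charts expression is `(φ_N ∘ f ∘ φ⁻¹) ∘ e⁻¹` on `e(range I)`, and
`D(F ∘ e⁻¹)(e y) = DF(y) ∘ e⁻¹`. [cite: Lee2013, Ch. 3, Prop. 3.6] -/
theorem mfderiv_transCLE_left (f : M → N) (x : M) :
    mfderiv (I.transContinuousLinearEquiv e) J f x = (mfderiv I J f x).comp (e.symm : E' →L[ℝ] E) := by
  by_cases hf : MDifferentiableAt I J f x
  · have hf' : MDifferentiableAt (I.transContinuousLinearEquiv e) J f x :=
      (mdifferentiableAt_transCLE_left I e).2 hf
    rw [hf'.mfderiv, hf.mfderiv, writtenInExtChartAt_transCLE_left, range_transCLE_eq_preimage,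
      extChartAt_transCLE_apply]
    have hU : UniqueDiffWithinAt ℝ (e.symm ⁻¹' range I) (e (extChartAt I x x)) := by
      rw [← e.image_eq_preimage_symm]
      exact (e.uniqueDiffOn_image_iff.2 I.uniqueDiffOn) _
        (mem_image_of_mem _ (mem_range_self _))
    rw [e.symm.comp_right_fderivWithin hU, e.symm_apply_apply]
    rfl
  · have hf' : ¬ MDifferentiableAt (I.transContinuousLinearEquiv e) J f x := fun h ↦
      hf ((mdifferentiableAt_transCLE_left I e).1 h)
    rw [mfderiv_zero_of_not_mdifferentiableAt hf', mfderiv_zero_of_not_mdifferentiableAt hf]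
    ext v
    rfl

/-- The differential applied to a vector, changed source model: `d f_x(w) = d f_x (e⁻¹ w)`.
[cite: Lee2013, Ch. 3, Prop. 3.6] -/
theorem mfderiv_transCLE_left_apply (f : M → N) (x : M)
    (w : TangentSpace (I.transContinuousLinearEquiv e) x) :
    mfderiv (I.transContinuousLinearEquiv e) J f x w = mfderiv I J f x (e.symm w) := by
  rw [mfderiv_transCLE_left]; rfl

/-! ### The identity between the two structures -/

section Identity

/-- The identity `(M, I.trans e) → (M, I)` is `C^n`. [folklore] -/
theorem contMDiff_id_transCLE {n : ℕ∞ω} :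
    ContMDiff (I.transContinuousLinearEquiv e) I n (id : M → M) :=
  (ContinuousLinearEquiv.contMDiff_transContinuousLinearEquiv_left e).2 contMDiff_id

/-- The identity `(M, I) → (M, I.trans e)` is `C^n`. [folklore] -/
theorem contMDiff_id_transCLE' {n : ℕ∞ω} :
    ContMDiff I (I.transContinuousLinearEquiv e) n (id : M → M) :=
  (ContinuousLinearEquiv.contMDiff_transContinuousLinearEquiv_right e).2 contMDiff_id

/-- **The differential of the identity `(M, I.trans e) → (M, I)` is `e⁻¹`** (as a map of the
model spaces `E' → E`, which are the tangent spaces). [cite: Lee2013, Ch. 3, Prop. 3.6] -/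
theorem mfderiv_id_transCLE (x : M) :
    mfderiv (I.transContinuousLinearEquiv e) I (id : M → M) x = (e.symm : E' →L[ℝ] E) := by
  rw [mfderiv_transCLE_left, mfderiv_id]
  ext w
  rfl

/-- **The differential of the identity `(M, I) → (M, I.trans e)` is `e`.**
[cite: Lee2013, Ch. 3, Prop. 3.6] -/
theorem mfderiv_id_transCLE' (x : M) :
    mfderiv I (I.transContinuousLinearEquiv e) (id : M → M) x = (e : E →L[ℝ] E') := by
  rw [mfderiv_transCLE_right, mfderiv_id]
  ext v
  rfl

/-- The differential of the identity `(M, I.trans e) → (M, I)` applied to a vector. [folklore] -/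
theorem mfderiv_id_transCLE_apply (x : M) (w : E') :
    mfderiv (I.transContinuousLinearEquiv e) I (id : M → M) x w = e.symm w := by
  rw [mfderiv_id_transCLE]; rfl

/-- The differential of the identity `(M, I) → (M, I.trans e)` applied to a vector. [folklore] -/
theorem mfderiv_id_transCLE'_apply (x : M) (v : E) :
    mfderiv I (I.transContinuousLinearEquiv e) (id : M → M) x v = e v := by
  rw [mfderiv_id_transCLE']; rfl

/-- The differential of the identity `(M, I.trans e) → (M, I)` is injective. [folklore] -/
theorem injective_mfderiv_id_transCLE (x : M) :
    Injective (mfderiv (I.transContinuousLinearEquiv e) I (id : M → M) x) := by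
  rw [mfderiv_id_transCLE]
  exact e.symm.injective

/-- The differential of the identity `(M, I) → (M, I.trans e)` is injective. [folklore] -/
theorem injective_mfderiv_id_transCLE' (x : M) :
    Injective (mfderiv I (I.transContinuousLinearEquiv e) (id : M → M) x) := by
  rw [mfderiv_id_transCLE']
  exact e.injective

end Identity

end Literature.Geometry.Riemannian

end
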